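import Summits.AtomisticToContinuum.FouriersLaw.Theorems.LatticeLandauDampingAbelThermodynamicLimitUniformAnchoredCorrelationTailsPropagation
import Literature.MathematicalPhysics.KineticTheory.InfiniteChainSevered
import Literature.MathematicalPhysics.KineticTheory.LangevinChainKernel
import Literature.MathematicalPhysics.KineticTheory.InfiniteChainLightConeProofs

/-!
# Open chain versus severed window: the pathwise Dobrushin–Fritz comparison (engine of stub (M1sev))

Helper (`--supports stmt-AtomisticToContinuum-14013`) for the line `series-law-at-every-laplace-frequency`
(SketchIdeator2) of the crux `LatticeLandauDamping.AbelThermodynamicLimit`, stub (M1sev)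
`stub_openChainSeveredLocality`. Registered sub-goal `pinnedChain_openChain_severed_pathwise`.

Deterministic core. `X_s = chainFlow x η s` is the strong solution of the open pinned chain driven by the momentum noise
`η = chainNoise N c_L c_R w` of a pair of raw paths (it vanishes at every interior site), read in `ℤ`-coordinates through
an embedding `ι` with `ι z l = (q_l, p_l)` on the chain; `Y_s = T^Λ_s(ι x)` is LLL's severed flow of the window
`Λ = [k-M, k+1+M]`, `M + 2 ≤ k`, `k + M + 3 < N` (so `Λ` and its outer neighbours are interior, non-bath sites). On `Λ`
both curves solve the SAME nearest-neighbour Hamiltonian equations with the same initial data; the discrepancy enters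
only through the outer neighbours `k-M-1`, `k+M+2` (moving for `X`, frozen for `Y`). If the positions of both curves at
the sites `[k-M-1, k+M+2]` stay in `[-R, R]` on `[0, t]`, the cubic forces are `Θ`-Lipschitz there,
`Θ = ω₂ + 3 lam R² + 4(1 + 12βR²)`, and the second-order Dobrushin–Fritz iteration (Buttà–Marchioro 2016 §3
(3.3)–(3.9), in integral form on `[0, t]`; adapted from `OscillatorChain.df_iterate`) gives at the central bond
`|Δq| ≤ 2R Θ^{M+1} t^{2M+2}/(2M+2)! ≤ 2R 2^{-(2M+2)}`, `|Δp| ≤ 2R Θ^{M+1} t^{2M+1}/(2M+1)! ≤ 2R√Θ 2^{-(2M+1)}` in the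
regime `2e√Θ t ≤ 2M+1`. Folklore; no definitions.
-/

noncomputable section

open MeasureTheory Set Filter Topology

namespace Summit.AtomisticToContinuum.FouriersLaw.Theorems.AbelThermodynamicLimit.SeriesLawAtEveryLaplaceFrequency

open Literature.MathematicalPhysics.KineticTheory Literature.MathematicalPhysics.KineticTheory.HeatConduction
open Literature.Probability.Process OscillatorChain
open Summit.AtomisticToContinuum.FouriersLaw.Theorems.NonBallistic.LightConePropagation

namespace SeveredLocality

variable {N : ℕ} {ω₂ lam β γ : ℝ}

/-! ### The cubic forces of the pinned chain on `ℤ`: box Lipschitz bound and continuity -/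

/-- **Box Lipschitz bound for the force of the pinned chain on `ℤ`.** If the positions of `σ, σ'` at the sites
`i-1, i, i+1` lie in `[-R, R]` and differ by at most `δ`, then
`|F_i(σ) - F_i(σ')| ≤ (ω₂ + 3 lam R² + 4(1 + 12βR²)) δ` (`U'(q) = ω₂q + lam q³`, `V'(r) = r + βr³`, bond
elongations are `≤ 2R`). [folklore] -/
theorem abs_force_sub_le (hω : 0 ≤ ω₂) (hl : 0 ≤ lam) (hβ : 0 ≤ β) (γ : ℝ) {R δ : ℝ} {σ σ' : ChainConfig}
    {i : ℤ} (hσ : ∀ j, i - 1 ≤ j → j ≤ i + 1 → |(σ j).1| ≤ R ∧ |(σ' j).1| ≤ R)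
    (hδ : ∀ j, i - 1 ≤ j → j ≤ i + 1 → |(σ j).1 - (σ' j).1| ≤ δ) :
    |(pinnedChain ω₂ lam β γ).force σ i - (pinnedChain ω₂ lam β γ).force σ' i| ≤
      (ω₂ + 3 * lam * R ^ 2 + 4 * (1 + 12 * β * R ^ 2)) * δ := by
  obtain ⟨h0, h0'⟩ := hσ i (by omega) (by omega); obtain ⟨hp, hp'⟩ := hσ (i + 1) (by omega) le_rfl
  obtain ⟨hm, hm'⟩ := hσ (i - 1) le_rfl (by omega)
  have d0 := hδ i (by omega) (by omega); have dp := hδ (i + 1) (by omega) le_rfl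
  have dm := hδ (i - 1) le_rfl (by omega)
  have hR : 0 ≤ R := (abs_nonneg _).trans h0
  set KV : ℝ := 1 + 12 * β * R ^ 2 with hKV
  have hKV0 : 0 ≤ KV := by positivity
  -- pinning term
  have hU : |(ω₂ * (σ i).1 + lam * (σ i).1 ^ 3) - (ω₂ * (σ' i).1 + lam * (σ' i).1 ^ 3)| ≤
      (ω₂ + 3 * lam * R ^ 2) * δ :=
    (abs_cubic_sub_cubic_le hω hl h0 h0').trans (mul_le_mul_of_nonneg_left d0 (by positivity))
  -- a bond term
  have hV : ∀ a b a' b' : ℝ, |a| ≤ R → |b| ≤ R → |a'| ≤ R → |b'| ≤ R → |a - a'| ≤ δ → |b - b'| ≤ δ →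
      |((a - b) + β * (a - b) ^ 3) - ((a' - b') + β * (a' - b') ^ 3)| ≤ KV * (2 * δ) := by
    intro a b a' b' ha hb ha' hb' hda hdb
    have h2 : |a - b| ≤ 2 * R := (abs_sub _ _).trans (by linarith)
    have h2' : |a' - b'| ≤ 2 * R := (abs_sub _ _).trans (by linarith)
    have h := abs_cubic_sub_cubic_le (c₁ := 1) zero_le_one hβ h2 h2'
    rw [one_mul, one_mul, show (1 + 3 * β * (2 * R) ^ 2) = KV by rw [hKV]; ring] at h
    refine h.trans ?_
    refine mul_le_mul_of_nonneg_left ?_ hKV0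
    calc |a - b - (a' - b')| = |(a - a') - (b - b')| := by ring_nf
      _ ≤ |a - a'| + |b - b'| := abs_sub _ _
      _ ≤ 2 * δ := by linarith
  have hV1 := hV _ _ _ _ hp h0 hp' h0' dp d0; have hV2 := hV _ _ _ _ h0 hm h0' hm' d0 dm
  rw [force_eq, force_eq]
  simp only [pinnedChain_deriv_U, pinnedChain_deriv_V]
  have key : ∀ u v w u' v' w' : ℝ, (-u + v - w) - (-u' + v' - w') = -(u - u') + (v - v') - (w - w') := by
    intros; ring
  rw [key]
  refine ((abs_sub _ _).trans (add_le_add ((abs_add_le _ _).trans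
    (add_le_add ((abs_neg _).le.trans hU) hV1)) hV2)).trans (le_of_eq ?_)
  rw [hKV]; ring

/-- The force of the pinned chain at a site is a continuous function of time along any continuous curve of
configurations (it is a polynomial in three coordinates). [folklore] -/
theorem continuous_force_comp (ω₂ lam β γ : ℝ) {c : ℝ → ChainConfig} (hc : Continuous c) (i : ℤ) :
    Continuous fun s => (pinnedChain ω₂ lam β γ).force (c s) i := by
  have h1 : ∀ j : ℤ, Continuous fun s => (c s j).1 := fun j =>
    continuous_fst.comp ((continuous_apply j).comp hc)
  simp only [force_eq, pinnedChain_deriv_U, pinnedChain_deriv_V]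
  have := h1 i; have := h1 (i + 1); have := h1 (i - 1)
  fun_prop

/-! ### The open chain read in `ℤ`-coordinates: interior sites are Hamiltonian -/

/-- The momentum noise of a pair of raw paths vanishes at every interior site. [folklore] -/
theorem chainNoise_apply_of_interior (c_L c_R : ℝ) (w : WienerPair) (t : ℝ) (l : Fin N) (h0 : l.val ≠ 0)
    (h1 : l.val ≠ N - 1) : chainNoise N c_L c_R w t l = 0 := by
  simp [chainNoise, h0, h1]

/-- **At an interior site the Langevin drift is the Hamiltonian force of the infinite chain**, read through an
embedding `ι` with `ι z l = (q_l, p_l)` on the sites of the chain: for `0 < l`, `l + 1 < N`,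
`Y(z)_{p,l} = F_l(ι z)`. [folklore] -/
theorem drift_snd_eq_force (ω₂ lam β γ : ℝ) {ι : PhaseSpace N → ChainConfig}
    (hι : ∀ (z : PhaseSpace N) (l : Fin N), ι z ((l : ℕ) : ℤ) = (z.1 l, z.2 l)) (z : PhaseSpace N) (l : Fin N)
    (h0 : 0 < l.val) (h1 : l.val + 1 < N) :
    ((pinnedChain ω₂ lam β γ).drift N z).2 l = (pinnedChain ω₂ lam β γ).force (ι z) ((l : ℕ) : ℤ) := by
  rw [pinnedChain_drift_apply]
  dsimp only
  have hw : bathWeight N l = 0 := by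
    simp only [bathWeight]
    rw [if_neg (by omega), if_neg (by omega), add_zero]
  rw [hw, mul_zero, zero_mul, sub_zero, OscillatorChain.dPotential_eq_closed, dif_pos h0, dif_pos h1, force_eq]
  have e0 : (ι z ((l : ℕ) : ℤ)).1 = z.1 l := by rw [hι]
  have ep : (ι z (((l : ℕ) : ℤ) + 1)).1 = z.1 ⟨l.val + 1, h1⟩ := by
    have : (((l : ℕ) : ℤ) + 1) = (((⟨l.val + 1, h1⟩ : Fin N) : ℕ) : ℤ) := by push_cast; ring
    rw [this, hι]
  have em : (ι z (((l : ℕ) : ℤ) - 1)).1 = z.1 ⟨l.val - 1, by omega⟩ := by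
    have : (((l : ℕ) : ℤ) - 1) = (((⟨l.val - 1, by omega⟩ : Fin N) : ℕ) : ℤ) := by
      show ((l.val : ℤ) - 1) = ((l.val - 1 : ℕ) : ℤ); omega
    rw [this, hι]
  rw [e0, ep, em]
  ring


/-- **The open chain at an interior site, in `ℤ`-coordinates**: for `0 < l`, `l + 1 < N` and `τ ≥ 0`,
`q_l(τ) = q_l(0) + ∫₀^τ p_l` and `p_l(τ) = p_l(0) + ∫₀^τ F_l(ι X_s) ds` — the momentum noise of a pair of raw paths
acts on the two bath sites only. [folklore] -/
theorem chainFlow_interior_apply (hω : 0 < ω₂) (hl : 0 ≤ lam) (hβ : 0 ≤ β) (hγ : 0 ≤ γ)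
    {ι : PhaseSpace N → ChainConfig} (hι : ∀ (z : PhaseSpace N) (l : Fin N), ι z ((l : ℕ) : ℤ) = (z.1 l, z.2 l))
    (x : PhaseSpace N) (c_L c_R : ℝ) (w : WienerPair) (l : Fin N) (h0 : 0 < l.val) (h1 : l.val + 1 < N)
    {τ : ℝ} (hτ : 0 ≤ τ) :
    (ι ((pinnedChain ω₂ lam β γ).chainFlow N x (chainNoise N c_L c_R w) τ) ((l : ℕ) : ℤ)).1 =
      (ι x ((l : ℕ) : ℤ)).1 + ∫ s in (0:ℝ)..τ,
        (ι ((pinnedChain ω₂ lam β γ).chainFlow N x (chainNoise N c_L c_R w) s) ((l : ℕ) : ℤ)).2 ∧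
    (ι ((pinnedChain ω₂ lam β γ).chainFlow N x (chainNoise N c_L c_R w) τ) ((l : ℕ) : ℤ)).2 =
      (ι x ((l : ℕ) : ℤ)).2 + ∫ s in (0:ℝ)..τ, (pinnedChain ω₂ lam β γ).force
        (ι ((pinnedChain ω₂ lam β γ).chainFlow N x (chainNoise N c_L c_R w) s)) ((l : ℕ) : ℤ) := by
  have hηc : Continuous (chainNoise N c_L c_R w) := continuous_chainNoise _ _ w
  simp only [hι]
  refine ⟨pinnedChain_chainFlow_fst_apply hω hl hβ hγ N x hηc l hτ, ?_⟩
  rw [pinnedChain_chainFlow_snd_apply hω hl hβ hγ N x hηc l hτ,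
    chainNoise_apply_of_interior c_L c_R w τ l (by omega) (by omega), add_zero]
  congr 1
  refine intervalIntegral.integral_congr fun s _ => ?_
  exact drift_snd_eq_force ω₂ lam β γ hι _ l h0 h1

/-- **The severed flow at a site of the window, in integral form**: `q_i(τ) = q_i(0) + ∫₀^τ p_i`,
`p_i(τ) = p_i(0) + ∫₀^τ F_i(T^Λ_s σ) ds` (LLL (9a)–(9b) integrated). [folklore] -/
theorem severedFlow_apply_integral (ω₂ lam β γ : ℝ) (hB1 : (pinnedChain ω₂ lam β γ).CondB1) (Λ : Finset ℤ)
    (σ : ChainConfig) {i : ℤ} (hi : i ∈ Λ) (τ : ℝ) :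
    (severedFlow hB1 Λ τ σ i).1 = (σ i).1 + ∫ s in (0:ℝ)..τ, (severedFlow hB1 Λ s σ i).2 ∧
    (severedFlow hB1 Λ τ σ i).2 = (σ i).2 + ∫ s in (0:ℝ)..τ,
      (pinnedChain ω₂ lam β γ).force (severedFlow hB1 Λ s σ) i := by
  have hsol := isSeveredSolution_severedFlow hB1 Λ σ
  have hc : Continuous fun s => severedFlow hB1 Λ s σ := continuous_severedFlow_curve hB1 Λ σ
  have h2c : Continuous fun s => (severedFlow hB1 Λ s σ i).2 := continuous_snd.comp ((continuous_apply i).comp hc)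
  have hFc := continuous_force_comp ω₂ lam β γ hc i
  have e1 := intervalIntegral.integral_eq_sub_of_hasDerivAt (fun s _ => (hsol.1 i hi s).1) (h2c.intervalIntegrable 0 τ)
  have e2 := intervalIntegral.integral_eq_sub_of_hasDerivAt (fun s _ => (hsol.1 i hi s).2) (hFc.intervalIntegrable 0 τ)
  simp only [severedFlow_zero] at e1 e2
  constructor
  · rw [e1]; ring
  · rw [e2]; ring

/-- `∫₀^s C r^n dr = C s^{n+1}/(n+1)`. [folklore] -/
theorem integral_const_mul_pow (C s : ℝ) (n : ℕ) :
    ∫ r in (0:ℝ)..s, C * r ^ n = C * s ^ (n + 1) / (n + 1) := by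
  rw [intervalIntegral.integral_const_mul, integral_pow, zero_pow (Nat.succ_ne_zero n), sub_zero]
  ring

/-- **The Dobrushin–Fritz iteration for the open chain against the severed window** (integral form on `[0, t]`,
adapted from `OscillatorChain.df_iterate`). With `X_s = chainFlow x η s` (noise of a pair of raw paths),
`Y_s = T^{[a,b]}_s(ι x)`, `2 ≤ a`, `b + 3 ≤ N`, and all positions of both curves at the sites `[a-1, b+1]` in `[-R, R]`
on `[0, t]`: for every `d` and every site `i ∈ [a-1+d, b+1-d]`, for `s ∈ [0, t]`,
`|q_i(X_s) - q_i(Y_s)| ≤ 2R Θ^d s^{2d}/(2d)!` and (for `d ≥ 1`) `|p_i(X_s) - p_i(Y_s)| ≤ 2R Θ^d s^{2d-1}/(2d-1)!`,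
`Θ = ω₂ + 3 lam R² + 4(1 + 12βR²)`. [folklore] -/
theorem window_iteration (hω : 0 < ω₂) (hl : 0 ≤ lam) (hβ : 0 ≤ β) (hγ : 0 ≤ γ)
    (hB1 : (pinnedChain ω₂ lam β γ).CondB1) {ι : PhaseSpace N → ChainConfig} (hιc : Continuous ι)
    (hι : ∀ (z : PhaseSpace N) (l : Fin N), ι z ((l : ℕ) : ℤ) = (z.1 l, z.2 l))
    (x : PhaseSpace N) (c_L c_R : ℝ) (w : WienerPair) {a b : ℤ} (ha : 2 ≤ a) (hab : a ≤ b) (hb : b + 3 ≤ N)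
    {R t : ℝ} (ht : 0 ≤ t)
    (hbox : ∀ s ∈ Icc (0:ℝ) t, ∀ j : ℤ, a - 1 ≤ j → j ≤ b + 1 →
      |(ι ((pinnedChain ω₂ lam β γ).chainFlow N x (chainNoise N c_L c_R w) s) j).1| ≤ R ∧
      |(severedFlow hB1 (Finset.Icc a b) s (ι x) j).1| ≤ R) :
    ∀ (d : ℕ) (i : ℤ), a - 1 + d ≤ i → i ≤ b + 1 - d → ∀ s ∈ Icc (0:ℝ) t,
      |(ι ((pinnedChain ω₂ lam β γ).chainFlow N x (chainNoise N c_L c_R w) s) i).1 -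
          (severedFlow hB1 (Finset.Icc a b) s (ι x) i).1| ≤
        2 * R * (ω₂ + 3 * lam * R ^ 2 + 4 * (1 + 12 * β * R ^ 2)) ^ d * s ^ (2 * d) / (2 * d).factorial ∧
      (1 ≤ d → |(ι ((pinnedChain ω₂ lam β γ).chainFlow N x (chainNoise N c_L c_R w) s) i).2 -
          (severedFlow hB1 (Finset.Icc a b) s (ι x) i).2| ≤
        2 * R * (ω₂ + 3 * lam * R ^ 2 + 4 * (1 + 12 * β * R ^ 2)) ^ d * s ^ (2 * d - 1) /
          (2 * d - 1).factorial) := by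
  set P := pinnedChain ω₂ lam β γ with hP
  set η := chainNoise N c_L c_R w with hη
  set X : ℝ → PhaseSpace N := fun s => P.chainFlow N x η s with hX
  set Y : ℝ → ChainConfig := fun s => severedFlow hB1 (Finset.Icc a b) s (ι x) with hY
  set Θ : ℝ := ω₂ + 3 * lam * R ^ 2 + 4 * (1 + 12 * β * R ^ 2) with hΘ
  have hιXc : Continuous fun s => ι (X s) :=
    hιc.comp (pinnedChain_continuous_chainFlow hω hl hβ hγ N x (continuous_chainNoise _ _ w))
  have hYc : Continuous Y := continuous_severedFlow_curve hB1 _ (ι x)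
  have hR : 0 ≤ R := (abs_nonneg _).trans (hbox 0 ⟨le_rfl, ht⟩ a (by omega) (by omega)).1
  have hΘ0 : 0 ≤ Θ := by positivity
  intro d
  induction d with
  | zero =>
    intro i hi1 hi2 s hs
    refine ⟨?_, fun h => absurd h (by norm_num)⟩
    obtain ⟨h1, h2⟩ := hbox s hs i (by omega) (by omega)
    rw [pow_zero, mul_one, mul_zero, pow_zero, mul_one, Nat.factorial_zero, Nat.cast_one, div_one]
    calc |(ι (X s) i).1 - (Y s i).1| ≤ |(ι (X s) i).1| + |(Y s i).1| := abs_sub _ _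
      _ ≤ R + R := add_le_add h1 h2
      _ = 2 * R := by ring
  | succ d ih =>
    intro i hi1 hi2
    push_cast at hi1 hi2
    have hiΛ : i ∈ Finset.Icc a b := by rw [Finset.mem_Icc]; omega
    have hi0 : 0 ≤ i := by omega
    set l : Fin N := ⟨i.toNat, by omega⟩ with hl_def
    have hli : ((l : ℕ) : ℤ) = i := by
      show ((i.toNat : ℕ) : ℤ) = i
      exact Int.toNat_of_nonneg hi0
    -- continuity of the integrands
    have hFc : Continuous fun r => P.force (ι (X r)) i - P.force (Y r) i :=
      (continuous_force_comp ω₂ lam β γ hιXc i).sub (continuous_force_comp ω₂ lam β γ hYc i)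
    have hp2c : Continuous fun r => (ι (X r) i).2 - (Y r i).2 :=
      (continuous_snd.comp ((continuous_apply i).comp hιXc)).sub
        (continuous_snd.comp ((continuous_apply i).comp hYc))
    -- the two differences as integrals (same initial data)
    have hDp_eq : ∀ s, 0 ≤ s → (ι (X s) i).2 - (Y s i).2 =
        ∫ r in (0:ℝ)..s, (P.force (ι (X r)) i - P.force (Y r) i) := by
      intro s hs
      obtain ⟨-, hX2⟩ := chainFlow_interior_apply hω hl hβ hγ hι x c_L c_R w l (by omega) (by omega) hs
      rw [hli] at hX2
      obtain ⟨-, hY2⟩ := severedFlow_apply_integral ω₂ lam β γ hB1 (Finset.Icc a b) (ι x) hiΛ s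
      rw [intervalIntegral.integral_sub ((continuous_force_comp ω₂ lam β γ hιXc i).intervalIntegrable _ _)
        ((continuous_force_comp ω₂ lam β γ hYc i).intervalIntegrable _ _)]
      show (ι (P.chainFlow N x η s) i).2 - (severedFlow hB1 (Finset.Icc a b) s (ι x) i).2 = _
      rw [hX2, hY2]
      ring
    have hDq_eq : ∀ s, 0 ≤ s → (ι (X s) i).1 - (Y s i).1 =
        ∫ r in (0:ℝ)..s, ((ι (X r) i).2 - (Y r i).2) := by
      intro s hs
      obtain ⟨hX1, -⟩ := chainFlow_interior_apply hω hl hβ hγ hι x c_L c_R w l (by omega) (by omega) hs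
      rw [hli] at hX1
      obtain ⟨hY1, -⟩ := severedFlow_apply_integral ω₂ lam β γ hB1 (Finset.Icc a b) (ι x) hiΛ s
      have i1 : IntervalIntegrable (fun r => (ι (X r) i).2) volume 0 s :=
        (continuous_snd.comp ((continuous_apply i).comp hιXc)).intervalIntegrable _ _
      have i2 : IntervalIntegrable (fun r => (Y r i).2) volume 0 s :=
        (continuous_snd.comp ((continuous_apply i).comp hYc)).intervalIntegrable _ _
      rw [intervalIntegral.integral_sub i1 i2]
      show (ι (P.chainFlow N x η s) i).1 - (severedFlow hB1 (Finset.Icc a b) s (ι x) i).1 = _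
      rw [hX1, hY1]
      ring
    -- momenta
    have hDp : ∀ s ∈ Icc (0:ℝ) t, |(ι (X s) i).2 - (Y s i).2| ≤
        2 * R * Θ ^ (d + 1) * s ^ (2 * d + 1) / (2 * d + 1).factorial := by
      intro s hs
      rw [hDp_eq s hs.1]
      have hbound : ∀ r ∈ Icc (0:ℝ) s, |P.force (ι (X r)) i - P.force (Y r) i| ≤
          Θ * (2 * R * Θ ^ d * r ^ (2 * d) / (2 * d).factorial) := by
        intro r hr
        have hrt : r ∈ Icc (0:ℝ) t := ⟨hr.1, hr.2.trans hs.2⟩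
        exact abs_force_sub_le hω.le hl hβ γ (fun j hj1 hj2 => hbox r hrt j (by omega) (by omega))
          (fun j hj1 hj2 => (ih j (by omega) (by omega) r hrt).1)
      have hbc : Continuous fun r : ℝ => Θ * (2 * R * Θ ^ d * r ^ (2 * d) / (2 * d).factorial) := by fun_prop
      calc |∫ r in (0:ℝ)..s, (P.force (ι (X r)) i - P.force (Y r) i)|
          ≤ ∫ r in (0:ℝ)..s, |P.force (ι (X r)) i - P.force (Y r) i| :=
            intervalIntegral.abs_integral_le_integral_abs hs.1
        _ ≤ ∫ r in (0:ℝ)..s, Θ * (2 * R * Θ ^ d * r ^ (2 * d) / (2 * d).factorial) :=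
            intervalIntegral.integral_mono_on hs.1 (hFc.abs.intervalIntegrable _ _) (hbc.intervalIntegrable _ _)
              hbound
        _ = ∫ r in (0:ℝ)..s, (Θ * (2 * R * Θ ^ d) / (2 * d).factorial) * r ^ (2 * d) :=
            intervalIntegral.integral_congr fun r _ => by ring
        _ = 2 * R * Θ ^ (d + 1) * s ^ (2 * d + 1) / (2 * d + 1).factorial := by
            rw [integral_const_mul_pow, Nat.factorial_succ (2 * d)]
            push_cast
            have hf : ((2 * d).factorial : ℝ) ≠ 0 := by positivity
            field_simp
            ring
    intro s hs
    refine ⟨?_, fun _ => ?_⟩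
    · rw [hDq_eq s hs.1]
      have hbc : Continuous fun r : ℝ => 2 * R * Θ ^ (d + 1) * r ^ (2 * d + 1) / (2 * d + 1).factorial := by
        fun_prop
      calc |∫ r in (0:ℝ)..s, ((ι (X r) i).2 - (Y r i).2)|
          ≤ ∫ r in (0:ℝ)..s, |(ι (X r) i).2 - (Y r i).2| := intervalIntegral.abs_integral_le_integral_abs hs.1
        _ ≤ ∫ r in (0:ℝ)..s, 2 * R * Θ ^ (d + 1) * r ^ (2 * d + 1) / (2 * d + 1).factorial :=
            intervalIntegral.integral_mono_on hs.1 (hp2c.abs.intervalIntegrable _ _) (hbc.intervalIntegrable _ _)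
              fun r hr => hDp r ⟨hr.1, hr.2.trans hs.2⟩
        _ = ∫ r in (0:ℝ)..s, (2 * R * Θ ^ (d + 1) / (2 * d + 1).factorial) * r ^ (2 * d + 1) :=
            intervalIntegral.integral_congr fun r _ => by ring
        _ = 2 * R * Θ ^ (d + 1) * s ^ (2 * (d + 1)) / (2 * (d + 1)).factorial := by
            rw [integral_const_mul_pow, show 2 * (d + 1) = (2 * d + 1) + 1 by ring, Nat.factorial_succ (2 * d + 1)]
            push_cast
            have hf : ((2 * d + 1).factorial : ℝ) ≠ 0 := by positivity
            field_simp
    · rw [show 2 * (d + 1) - 1 = 2 * d + 1 by omega]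
      exact hDp s hs


/-- **The pathwise core at the central bond.** In the setting of `window_iteration` with the window
`Λ = [k-M, k+1+M]`, `M + 2 ≤ k`, `k + M + 3 < N`, and in the regime `2e √Θ t ≤ 2M + 1`: at the sites `k`, `k+1`
and at time `t`, `|Δq| ≤ 2R (1/2)^{2M+2}` and `|Δp| ≤ 2R √Θ (1/2)^{2M+1}` (`c^m/m! ≤ 2^{-m}` once `2ec ≤ m`).
[folklore] -/
theorem central_bond_estimate (hω : 0 < ω₂) (hl : 0 ≤ lam) (hβ : 0 ≤ β) (hγ : 0 ≤ γ)
    (hB1 : (pinnedChain ω₂ lam β γ).CondB1) {ι : PhaseSpace N → ChainConfig} (hιc : Continuous ι)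
    (hι : ∀ (z : PhaseSpace N) (l : Fin N), ι z ((l : ℕ) : ℤ) = (z.1 l, z.2 l))
    (x : PhaseSpace N) (c_L c_R : ℝ) (w : WienerPair) (k : Fin N) {M : ℕ} (hk : M + 2 ≤ k.val)
    (hkN : k.val + M + 3 < N) {R t : ℝ} (ht : 0 ≤ t)
    (hbox : ∀ s ∈ Icc (0:ℝ) t, ∀ j : ℤ, (k.val : ℤ) - M - 1 ≤ j → j ≤ (k.val : ℤ) + M + 2 →
      |(ι ((pinnedChain ω₂ lam β γ).chainFlow N x (chainNoise N c_L c_R w) s) j).1| ≤ R ∧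
      |(severedFlow hB1 (Finset.Icc ((k.val : ℤ) - M) ((k.val : ℤ) + 1 + M)) s (ι x) j).1| ≤ R)
    (hreg : 2 * Real.exp 1 * (Real.sqrt (ω₂ + 3 * lam * R ^ 2 + 4 * (1 + 12 * β * R ^ 2)) * t) ≤ 2 * M + 1)
    (i : ℤ) (hi1 : (k.val : ℤ) ≤ i) (hi2 : i ≤ (k.val : ℤ) + 1) :
    |(ι ((pinnedChain ω₂ lam β γ).chainFlow N x (chainNoise N c_L c_R w) t) i).1 -
        (severedFlow hB1 (Finset.Icc ((k.val : ℤ) - M) ((k.val : ℤ) + 1 + M)) t (ι x) i).1| ≤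
      2 * R * (1 / 2) ^ (2 * M + 2) ∧
    |(ι ((pinnedChain ω₂ lam β γ).chainFlow N x (chainNoise N c_L c_R w) t) i).2 -
        (severedFlow hB1 (Finset.Icc ((k.val : ℤ) - M) ((k.val : ℤ) + 1 + M)) t (ι x) i).2| ≤
      2 * R * Real.sqrt (ω₂ + 3 * lam * R ^ 2 + 4 * (1 + 12 * β * R ^ 2)) * (1 / 2) ^ (2 * M + 1) := by
  set Θ : ℝ := ω₂ + 3 * lam * R ^ 2 + 4 * (1 + 12 * β * R ^ 2) with hΘ
  have hR : 0 ≤ R := (abs_nonneg _).trans (hbox 0 ⟨le_rfl, ht⟩ (k.val : ℤ) (by omega) (by omega)).1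
  have hΘ0 : 0 ≤ Θ := by positivity
  have hit := window_iteration hω hl hβ hγ hB1 hιc hι x c_L c_R w (a := (k.val : ℤ) - M) (b := (k.val : ℤ) + 1 + M)
    (by omega) (by omega) (by omega) ht (fun s hs j hj1 hj2 => hbox s hs j (by omega) (by omega)) (M + 1) i
    (by push_cast; omega) (by push_cast; omega) t ⟨ht, le_rfl⟩
  rw [← hΘ] at hit
  obtain ⟨hq, hp⟩ := hit
  have hp := hp (by omega)
  set c : ℝ := Real.sqrt Θ * t with hc
  have hc0 : 0 ≤ c := mul_nonneg (Real.sqrt_nonneg _) ht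
  have hsq : Real.sqrt Θ ^ 2 = Θ := Real.sq_sqrt hΘ0
  have e1 : Θ ^ (M + 1) * t ^ (2 * (M + 1)) = c ^ (2 * M + 2) := by
    calc Θ ^ (M + 1) * t ^ (2 * (M + 1)) = (Real.sqrt Θ ^ 2) ^ (M + 1) * t ^ (2 * (M + 1)) := by rw [hsq]
      _ = c ^ (2 * M + 2) := by rw [hc, ← pow_mul, mul_pow]; ring_nf
  have e2 : Θ ^ (M + 1) * t ^ (2 * (M + 1) - 1) = Real.sqrt Θ * c ^ (2 * M + 1) := by
    rw [show 2 * (M + 1) - 1 = 2 * M + 1 by omega]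
    calc Θ ^ (M + 1) * t ^ (2 * M + 1) = (Real.sqrt Θ ^ 2) ^ (M + 1) * t ^ (2 * M + 1) := by rw [hsq]
      _ = Real.sqrt Θ * c ^ (2 * M + 1) := by rw [hc, ← pow_mul, mul_pow]; ring
  have hreg2 : 2 * Real.exp 1 * c ≤ ((2 * M + 2 : ℕ) : ℝ) := by push_cast; linarith
  have hreg1 : 2 * Real.exp 1 * c ≤ ((2 * M + 1 : ℕ) : ℝ) := by push_cast; linarith
  have k1 := BMLightCone.pow_div_factorial_le_half_pow hc0 (m := 2 * M + 2) (by omega) hreg2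
  have k2 := BMLightCone.pow_div_factorial_le_half_pow hc0 (m := 2 * M + 1) (by omega) hreg1
  constructor
  · calc _ ≤ 2 * R * Θ ^ (M + 1) * t ^ (2 * (M + 1)) / ((2 * (M + 1)).factorial : ℝ) := hq
      _ = 2 * R * (c ^ (2 * M + 2) / ((2 * M + 2).factorial : ℝ)) := by
          rw [show 2 * (M + 1) = 2 * M + 2 by ring] at e1 ⊢; rw [mul_assoc (2 * R), e1]; ring
      _ ≤ 2 * R * (1 / 2) ^ (2 * M + 2) := mul_le_mul_of_nonneg_left k1 (by positivity)
  · calc _ ≤ 2 * R * Θ ^ (M + 1) * t ^ (2 * (M + 1) - 1) / ((2 * (M + 1) - 1).factorial : ℝ) := hp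
      _ = 2 * R * Real.sqrt Θ * (c ^ (2 * M + 1) / ((2 * M + 1).factorial : ℝ)) := by
          rw [show 2 * (M + 1) - 1 = 2 * M + 1 by omega] at e2 ⊢; rw [mul_assoc (2 * R), e2]; ring
      _ ≤ 2 * R * Real.sqrt Θ * (1 / 2) ^ (2 * M + 1) := mul_le_mul_of_nonneg_left k2 (by positivity)

end SeveredLocality

open SeveredLocality in
/-- **Registered helper `pinnedChain_openChain_severed_pathwise`** (pathwise core of stub (M1sev)
`stub_openChainSeveredLocality`, line `series-law-at-every-laplace-frequency`): the strong solution of the open pinned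
anharmonic chain driven by the momentum noise of a pair of raw paths, read in `ℤ`-coordinates through an embedding
`ι` of the chain, and LLL's severed flow of the window `[k-M, k+1+M]` started from the embedded initial condition,
whose positions at the sites `[k-M-1, k+M+2]` both stay in `[-R, R]` on `[0, t]`, differ at the central bond `(k, k+1)` at
time `t` by at most `2R·2^{-(2M+2)}` in position and `2R√Θ·2^{-(2M+1)}` in momentum, `Θ = ω₂ + 3 lam R² + 4(1+12βR²)`, in
the regime `2e√Θ t ≤ 2M+1` (second-order Dobrushin–Fritz iteration from the frozen/moving outer neighbours inward).
[folklore] -/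
theorem pinnedChain_openChain_severed_pathwise :
    ∀ ω₂ lam β γ : ℝ, 0 < ω₂ → 0 ≤ lam → 0 ≤ β → 0 ≤ γ →
      ∀ (hB1 : (Literature.MathematicalPhysics.KineticTheory.HeatConduction.pinnedChain ω₂ lam β γ).CondB1) (N : ℕ)
        (ι : Literature.MathematicalPhysics.KineticTheory.HeatConduction.PhaseSpace N →
          Literature.MathematicalPhysics.KineticTheory.HeatConduction.ChainConfig), Continuous ι →
        (∀ (z : Literature.MathematicalPhysics.KineticTheory.HeatConduction.PhaseSpace N) (l : Fin N),
          ι z ((l : ℕ) : ℤ) = (z.1 l, z.2 l)) →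
        ∀ (x : Literature.MathematicalPhysics.KineticTheory.HeatConduction.PhaseSpace N) (c_L c_R : ℝ)
          (w : Literature.Probability.Process.WienerPair) (k : Fin N) (M : ℕ), M + 2 ≤ k.val → k.val + M + 3 < N →
        ∀ (R t : ℝ), 0 ≤ t →
        (∀ s ∈ Set.Icc (0:ℝ) t, ∀ j : ℤ, (k.val : ℤ) - M - 1 ≤ j → j ≤ (k.val : ℤ) + M + 2 →
          |(ι ((Literature.MathematicalPhysics.KineticTheory.HeatConduction.pinnedChain ω₂ lam β γ).chainFlow N x
              (Literature.MathematicalPhysics.KineticTheory.HeatConduction.chainNoise N c_L c_R w) s) j).1| ≤ R ∧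
          |(Literature.MathematicalPhysics.KineticTheory.HeatConduction.OscillatorChain.severedFlow hB1
              (Finset.Icc ((k.val : ℤ) - M) ((k.val : ℤ) + 1 + M)) s (ι x) j).1| ≤ R) →
        2 * Real.exp 1 * (Real.sqrt (ω₂ + 3 * lam * R ^ 2 + 4 * (1 + 12 * β * R ^ 2)) * t) ≤ 2 * M + 1 →
        ∀ i : ℤ, (k.val : ℤ) ≤ i → i ≤ (k.val : ℤ) + 1 →
          |(ι ((Literature.MathematicalPhysics.KineticTheory.HeatConduction.pinnedChain ω₂ lam β γ).chainFlow N x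
                (Literature.MathematicalPhysics.KineticTheory.HeatConduction.chainNoise N c_L c_R w) t) i).1 -
              (Literature.MathematicalPhysics.KineticTheory.HeatConduction.OscillatorChain.severedFlow hB1
                (Finset.Icc ((k.val : ℤ) - M) ((k.val : ℤ) + 1 + M)) t (ι x) i).1| ≤ 2 * R * (1 / 2) ^ (2 * M + 2) ∧
          |(ι ((Literature.MathematicalPhysics.KineticTheory.HeatConduction.pinnedChain ω₂ lam β γ).chainFlow N x
                (Literature.MathematicalPhysics.KineticTheory.HeatConduction.chainNoise N c_L c_R w) t) i).2 -
              (Literature.MathematicalPhysics.KineticTheory.HeatConduction.OscillatorChain.severedFlow hB1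
                (Finset.Icc ((k.val : ℤ) - M) ((k.val : ℤ) + 1 + M)) t (ι x) i).2| ≤
            2 * R * Real.sqrt (ω₂ + 3 * lam * R ^ 2 + 4 * (1 + 12 * β * R ^ 2)) * (1 / 2) ^ (2 * M + 1) :=
  fun _ _ _ _ hω hl hβ hγ hB1 _ _ hιc hι x c_L c_R w k _ hk hkN _ _ ht hbox hreg i hi1 hi2 =>
    central_bond_estimate hω hl hβ hγ hB1 hιc hι x c_L c_R w k hk hkN ht hbox hreg i hi1 hi2

end Summit.AtomisticToContinuum.FouriersLaw.Theorems.AbelThermodynamicLimit.SeriesLawAtEveryLaplaceFrequency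

end
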